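import Summits.QuantumFields.YangMills.Theorems.UnitScaleTiltProp7CornerCombLinesInhabited
import Summits.QuantumFields.YangMills.Theorems.UnitScaleTiltProp7CornerCombLambdaClosureSharp
import HarnessLib

/-!
# Route `UnitScaleTilt`, crux K1 «MinimiserStabilityRegPr» (stmt-QuantumFields-19200), route-R (β) (n3)-comb lane (II) ∕ `hMcomb₂` ⟸ H2-1(E) —
# FILE G «THE CELL THEOREM'S GRADIENT LINE IN MEMBER LETTERS»: THE COMB TOWER'S LEVEL COVARIANT GRADIENT OVER A PERIOD CELL, PURE B-SLOT,
# THE GAUGE ROW DISPLAYED — THE MEMBER FORM OF THE DISPLAYED ROW (G_j)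

Cell `ym3-torus`, width seat `ym3-torus-px18` (gen 5); the member TWIN of w5 g8's F-8b-4 `sum_cell_normSq_tild_le_two_slot` (binder list VERBATIM, same displayed scalar
gauge row `hrow`), exporting the GRADIENT instead of the MASS.  THEOREMS ONLY (0 `def`, 0 `sorry`); `--supports stmt-QuantumFields-19200 --as helper`, count-neutral.
YM₃ on T³ is a ladder rung (R3), not the Clay problem; nothing here claims `hMcomb`, `hMcomb₂`, (β), the stub, the crux, d = 4 or the mass gap.

THE POINT (LOCATE `ym3-torus-px18/g5/LOCATE-GJ-SUPPLIER-px18g5.md`, 19200 evidence #60; SPEC F-8 §2).  Data as in F-8b-4: `N′Lᵏ`-periodic unitary-valued `U₀`, `U₁` on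
`ℤᵈ`; the comb tower `Ỹ_j = Ũʲ − 1`, its source `rem_j`, the SPLIT reduced families `G^{lin}`, `N` and the gauge function `Λ` (✓F-8b-1), the level windows as hypotheses,
the scalar gauge row `hrow` of ✓F-7c-3 in the cell letters `m n g lam` DISPLAYED (★routeR-w6's F-6d-3 read through the DEF slot — discharged by F-8b-5b, not here).
CONCLUSION ★★★ `sum_cell_covGrad_tild_le_B_slot`: for every `l ≤ k`,
`Σ_{t ∈ [0,N′L^{k−l})ᵈ} Σ_κ Σ_ν ‖Ad_{Ūˡ(t̂,ν)}(Ỹ_l(t̂ + e_ν, κ)) − Ỹ_l(t̂, κ)‖² ≤ (4·Ĝ² + 16d·Qn♯² + 8d·S♯²)·((ρ⁻¹)ˡ)²` with the ANCHORED closed letters of ✓FILE S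
`Prop7CornerCombLambdaClosureSharp.grad_full_B_slot_of_rows` at `(uG,uN,uL) = (4, 16d, 8d)`: `Ĝ = g₀ + θ_g·e′·m₀·ρ^{2k}·ρ³∕(1−ρ²)`,
`Qn♯ = 2e′θ₂(e′m₀·ρ^{2k+1}∕(1−ρ²) + (cB0 + cAρ^{2k})ρ³∕(1−ρ⁴))`, `S♯ = cB0 + cAρ^{2k} + cB1·Qn♯` — NO A-SLOT (`m₀` only anchored; on `T³` `((ρ⁻¹)ˡ)² = Lˡ`,
`ρ^{2k} = (Lᵏ)⁻¹ = η`): the (G_j) shape `GRADcov_cell(Ỹ_l) ≤ BG²·Lˡ`, `BG²` ∈ {GRAD₀, η²·MASS₀} × windows; and ★★ `sum_cell_normGap_le_covGrad` — the displayed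
norm-gap letter of w3-20520 g12's `hGc` ∕ px17 g5's `hG` (`Σ_{y,ν,μ}(‖Ỹ(ŷ+e_μ) ν‖ − ‖Ỹ ŷ ν‖)²`) is termwise below the covariant gradient at a `U1` background.
PROOF = F-8b-4's inhabitation VERBATIM (periodicity ✓F-8a∕✓F-8b-1, the four rows of ✓F-8b-2, ✓F-7a's structure identity) plus the full-field gradient row
`γ_j² ≤ 4g_j² + 16d·n_j² + 8d·λ_j²` from ✓F-8b-2 `sum_cell_covGrad_add_le` applied twice to `Ỹ_j = (G^{lin}_j + N_j) + ∇^{cov}Λ_j`, then ✓FILE S.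
HONEST SCOPE.  Assembly only; `d` general with `√(L²L⁻ᵈ) = ρ`, `√(L⁴L⁻ᵈ) = ρ⁻¹` as hypotheses (true at `d = 3`, `ρ = (√L)⁻¹`); every window∕smallness∕constant inequality and
the gauge row `hrow` are hypotheses (F-8c-3 ∕ F-8b-5b discharge them); `𝔸` any non-trivial C⋆-algebra.  §1's four bookkeeping letters are PRIVATE copies of F-8b-4 v2 §1
(HOME `ym-ust-19200-w5/g8`, not yet in the tree) so that neither file restates the other.

References: T. Bałaban, CMP **109** (1987) 249–301 [Balaban1987RG1] ((0.1), (0.4) pp.251–253: the inductive level bounds incl. the gauge-field gradients); CMP **98** (1985) 17–51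
[Balaban1985Averaging] ((2), (42)–(43), (68)–(69), Prop. 3 (122)–(126)); CMP **95** (1984) 17–40 [Balaban1984PropagatorsI] ((1.18)–(1.20)).
-/

set_option autoImplicit false

noncomputable section

open scoped BigOperators
open Finset

namespace Summit.QuantumFields.YangMills.Theorems.Prop7CornerCombCellGradMember

open NormedSpace
open Literature.MathematicalPhysics.QuantumFieldTheory.Balaban1983to89
open ExpMeanLog (eml)
open B7Prop1Explicit renaming Site → LSite
open B7Prop1Explicit (Letter e hol seg boxVec gammaWord plaqWord Wcx Xavg bavg expUnit U1)
open B7Prop2Explicit (avgIter unitaryUnits unitaryUnits_le_U1)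
open B7Eq92Concrete (tildIter)
open B7Eq78Linearization (conjR conjR_apply)
open B7Prop3GeneralRotated (tsum norm_conjR_le)
open B7Prop3GeneralLinear (FhatCov)
open B12Ineq417Flat (shiftCfg shiftCfg_apply)
open T4TermwiseTorus (IsPeriodic)
open Summit.QuantumFields.YangMills.Theorems.Prop7CombPeriodCellDict (shiftCfg_eq_of_isPeriodic isPeriodic_avgIter isPeriodic_tildIter_le)
open Summit.QuantumFields.YangMills.Theorems.Prop7CornerCombSourcedStructure (sourced_cornerComb_structure)
open Summit.QuantumFields.YangMills.Theorems.Prop7CornerCombFamiliesPeriodic (trueStep_shiftCfg smul_add_period isPeriodic_sourced_families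
  apply_add_period_of_isPeriodic apply_add_period_of_isPeriodic' period_tower_step exists_gauge_family cornerCharge_add sourced_recursion_of_split)
open Summit.QuantumFields.YangMills.Theorems.Prop7CornerCombLinesInhabited (sqrt_mass_lin_step_le sqrt_mass_sourced_step_le sqrt_grad_lin_step_le sqrt_mass_full_le
  sum_cell_covGrad_add_le)
open Summit.QuantumFields.YangMills.Theorems.Prop7CornerCombLambdaClosureSharp (grad_full_B_slot_of_rows)

variable {d : ℕ} {𝔸 : Type*} [CStarAlgebra 𝔸]

/-! ## §1 Bookkeeping (private copies of F-8b-4 v2 §1): cells along the period tower, the source is periodic -/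

omit [CStarAlgebra 𝔸] in
/-- Cell sums along equal periods agree (`Fin n` vs `Fin n′` for `n = n′`). [folklore] -/
private theorem sum_boxVec_congr {M : Type*} [AddCommMonoid M] {n n' : ℕ} (h : n = n') (f : LSite d → M) :
    ∑ t : Fin d → Fin n, f (boxVec n t) = ∑ t : Fin d → Fin n', f (boxVec n' t) := by
  subst h; rfl

/-- The source of the comb tower is periodic: for `N′L`-periodic `V`, `Y` and `N′`-periodic `Y′`, `rem(z,κ) = Y′(z,κ) − T_V(Y)(L•z,κ)` is `N′`-periodic
(✓F-8b-1 `trueStep_shiftCfg`). [cite: Balaban1987RG1, (0.1) p.251; Balaban1985Averaging, (68)–(69) p.29] -/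
private theorem rem_isPeriodic (L N N' : ℕ) (hN : N = N' * L) (V : LSite d → Fin d → 𝔸ˣ) (hV : IsPeriodic N V) (Y Y' : LSite d → Fin d → 𝔸)
    (hY : IsPeriodic N Y) (hY' : IsPeriodic N' Y') (rem : LSite d → Fin d → 𝔸)
    (hrem : ∀ (z : LSite d) (κ : Fin d), rem z κ = Y' z κ
      - (fderiv ℂ (eml : ((Fin d → Fin L) → 𝔸) → 𝔸) (fun r => ((Wcx L V ((L : ℤ) • z) κ (boxVec L r) : 𝔸ˣ) : 𝔸))
            (fun r => tsum V Y ((L : ℤ) • z) (gammaWord L κ (boxVec L r) ++ seg κ (-(L : ℤ))) * ((Wcx L V ((L : ℤ) • z) κ (boxVec L r) : 𝔸ˣ) : 𝔸))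
            * (((expUnit (Xavg L V ((L : ℤ) • z) κ))⁻¹ : 𝔸ˣ) : 𝔸)
          + ((expUnit (Xavg L V ((L : ℤ) • z) κ) : 𝔸ˣ) : 𝔸) * tsum V Y ((L : ℤ) • z) (seg κ (L : ℤ)) * (((expUnit (Xavg L V ((L : ℤ) • z) κ))⁻¹ : 𝔸ˣ) : 𝔸))) :
    IsPeriodic N' rem := by
  intro x m
  funext κ
  have hVs := shiftCfg_eq_of_isPeriodic hV m
  have hYs := shiftCfg_eq_of_isPeriodic hY m
  rw [hrem, hrem, smul_add_period L N N' hN x m, ← trueStep_shiftCfg L ((N : ℤ) • m) V Y ((L : ℤ) • x) κ, hVs, hYs, hY' x m]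

/-- `Ỹ_j = Ũʲ − 1` is `N′L^{k−j}`-periodic for `N′Lᵏ`-periodic data (✓F-8a `isPeriodic_tildIter_le`). [cite: Balaban1985Averaging, (69) p.29] -/
private theorem tildField_isPeriodic (L N' k : ℕ) {U₀ U₁ : LSite d → Fin d → 𝔸ˣ} (hU₀ : IsPeriodic (N' * L ^ k) U₀) (hU₁ : IsPeriodic (N' * L ^ k) U₁)
    (Yt : ℕ → LSite d → Fin d → 𝔸) (hYt : ∀ (i : ℕ) (x : LSite d) (μ : Fin d), Yt i x μ = ((tildIter L U₀ U₁ i x μ : 𝔸ˣ) : 𝔸) - 1)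
    {j : ℕ} (hj : j ≤ k) : IsPeriodic (N' * L ^ (k - j)) (Yt j) := by
  intro x m'
  funext μ
  rw [hYt, hYt, isPeriodic_tildIter_le L N' k hU₀ hU₁ hj x m']

/-- `Ūʲ` is `N′L^{k−j}`-periodic for `N′Lᵏ`-periodic `U₀` (✓F-8a `isPeriodic_avgIter`). [cite: Balaban1985Averaging, (43) p.24] -/
private theorem avgIter_isPeriodic_level (L N' k : ℕ) {U₀ : LSite d → Fin d → 𝔸ˣ} (hU₀ : IsPeriodic (N' * L ^ k) U₀) {j : ℕ} (hj : j ≤ k) :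
    IsPeriodic (N' * L ^ (k - j)) (avgIter L U₀ j) := by
  refine isPeriodic_avgIter L (N' * L ^ (k - j)) j ?_
  rwa [mul_assoc, ← pow_add, Nat.sub_add_cancel hj]

/-! ## §2 The norm gap sits below the covariant gradient at a `U1` background -/

variable [Nontrivial 𝔸]

/-- Conjugation by a `U1` unit is an isometry: `‖u·X·u⁻¹‖ = ‖X‖` (✓`norm_conjR_le` both ways, `U1` a subgroup). [folklore] -/
private theorem norm_conjR_eq {u : 𝔸ˣ} (hu : u ∈ U1 𝔸) (X : 𝔸) : ‖conjR u X‖ = ‖X‖ := by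
  refine le_antisymm (norm_conjR_le hu X) ?_
  have h := norm_conjR_le ((U1 𝔸).inv_mem hu) (conjR u X)
  have e1 : conjR u⁻¹ (conjR u X) = X := by
    rw [conjR_apply, conjR_apply, inv_inv, ← mul_assoc, ← mul_assoc, Units.inv_mul, one_mul, mul_assoc, Units.inv_mul, mul_one]
  rwa [e1] at h

/-- The pointwise norm-gap letter: `(‖a‖ − ‖b‖)² ≤ ‖u·a·u⁻¹ − b‖²` for `u ∈ U1`. [folklore] -/
private theorem sq_norm_sub_norm_le_conjR {u : 𝔸ˣ} (hu : u ∈ U1 𝔸) (a b : 𝔸) : (‖a‖ - ‖b‖) ^ 2 ≤ ‖conjR u a - b‖ ^ 2 := by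
  have h := abs_norm_sub_norm_le (conjR u a) b
  rw [norm_conjR_eq hu] at h
  obtain ⟨h1, h2⟩ := abs_le.mp h
  exact sq_le_sq' h1 h2

/-- ★★ **THE NORM GAP SITS BELOW THE COVARIANT GRADIENT** (cell form): at a `U1`-valued background `V`, for any `X` on `ℤᵈ` and any cell size `M`,
`Σ_{t,ν,μ} (‖X(t̂ + e_μ, ν)‖ − ‖X(t̂, ν)‖)² ≤ Σ_{t,κ,ν} ‖Ad_{V(t̂,ν)}(X(t̂ + e_ν, κ)) − X(t̂, κ)‖²` — the displayed letter of w3-20520 g12's `hGc` ∕ px17 g5's `hG` (outer index =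
component, inner = shift) read off the covariant-gradient cell sum. [folklore] -/
theorem sum_cell_normGap_le_covGrad (M : ℕ) (V : LSite d → Fin d → 𝔸ˣ) (hV : ∀ x μ, V x μ ∈ U1 𝔸) (X : LSite d → Fin d → 𝔸) :
    ∑ t : Fin d → Fin M, ∑ ν : Fin d, ∑ μ : Fin d, (‖X (boxVec M t + e μ) ν‖ - ‖X (boxVec M t) ν‖) ^ 2
      ≤ ∑ t : Fin d → Fin M, ∑ κ : Fin d, ∑ ν : Fin d, ‖conjR (V (boxVec M t) ν) (X (boxVec M t + e ν) κ) - X (boxVec M t) κ‖ ^ 2 :=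
  Finset.sum_le_sum fun _ _ => Finset.sum_le_sum fun _ _ => Finset.sum_le_sum fun _ _ => sq_norm_sub_norm_le_conjR (hV _ _) _ _

/-! ## §3 ★★★ The cell theorem's gradient line in member letters (the gauge row displayed) -/

-- hb: the F-8b-4-size binder list + the level-by-level inhabitation measure > 100k < 200k heartbeats (README HEARTBEAT BUDGET rule: decl-local, never file-global)
set_option maxHeartbeats 400000 in
/-- ★★★ **THE COMB TOWER'S LEVEL COVARIANT GRADIENT OVER A PERIOD CELL, PURE B-SLOT** (the member twin of F-8b-4 `sum_cell_normSq_tild_le_two_slot`; binder list VERBATIM,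
the scalar gauge row DISPLAYED as `hrow`).  The letters `m n g y lam` are the cell `√Σ`'s of `G^{lin}`, `N`, `G^{lin}`'s covariant gradient, `Ỹ`, and `Λ`'s covariant gradient
over the level cells `{boxVec (N′L^{k−j}) t}`.  CONCLUSION: for every `l ≤ k`,
`Σ_{t,κ,ν} ‖Ad_{Ūˡ(boxVec t, ν)}(Ũˡ(boxVec t + e_ν, κ) − 1) − (Ũˡ(boxVec t, κ) − 1)‖² ≤ (4·Ĝ² + 16d·Qn♯² + 8d·S♯²)·((ρ⁻¹)ˡ)²` with the anchored closed letters of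
✓`Prop7CornerCombLambdaClosureSharp.grad_full_B_slot_of_rows` (module docstring) — no A-slot.
[cite: Balaban1987RG1, (0.1), (0.4) pp.251–253; Balaban1985Averaging, Prop. 3 (122)–(126) p.36, (68)–(69) p.29] -/
theorem sum_cell_covGrad_tild_le_B_slot (L N' k : ℕ) (hL : 1 ≤ L) (hN' : 0 < N') (U₀ U₁ : LSite d → Fin d → 𝔸ˣ)
    (hU₀ : IsPeriodic (N' * L ^ k) U₀) (hU₁ : IsPeriodic (N' * L ^ k) U₁)
    (hVu : ∀ j ≤ k, ∀ x μ, avgIter L U₀ j x μ ∈ unitaryUnits 𝔸) (hTu : ∀ j < k, ∀ x μ, tildIter L U₀ U₁ j x μ ∈ U1 𝔸)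
    (α a μ : ℕ → ℝ) (hα0 : ∀ j, 0 ≤ α j) (hα24 : ∀ j < k, α j ≤ 1 / 24)
    (hα : ∀ j < k, ∀ (z : LSite d) (κ : Fin d) (r : Fin d → Fin L), ‖((Wcx L (avgIter L U₀ j) ((L : ℤ) • z) κ (boxVec L r) : 𝔸ˣ) : 𝔸) - 1‖ ≤ α j)
    (ha0 : ∀ j, 0 ≤ a j) (hplaq : ∀ j < k, ∀ (x : LSite d) (κ' μ' : Fin d), κ' ≠ μ' → ‖((hol (avgIter L U₀ j) x (plaqWord κ' μ') : 𝔸ˣ) : 𝔸) - 1‖ ≤ a j)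
    (hμ0 : ∀ j, 0 ≤ μ j) (hμ72 : ∀ j < k, 72 * μ j ≤ 1)
    (Yt : ℕ → LSite d → Fin d → 𝔸) (hYt : ∀ (i : ℕ) (x : LSite d) (μ' : Fin d), Yt i x μ' = ((tildIter L U₀ U₁ i x μ' : 𝔸ˣ) : 𝔸) - 1)
    (hμ : ∀ j < k, ∀ (z : Fin d → Fin (N' * L ^ (k - (j + 1)))) (κ : Fin d), (2 * d + 2) * L * Real.sqrt (∑ s : Fin d → Fin L, ∑ ν : Fin d,
      (‖Yt j ((L : ℤ) • boxVec (N' * L ^ (k - (j + 1))) z + boxVec L s) ν‖ ^ 2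
        + ‖Yt j ((L : ℤ) • boxVec (N' * L ^ (k - (j + 1))) z + (L : ℤ) • e κ + boxVec L s) ν‖ ^ 2)) ≤ μ j)
    (Glin Nn rem : ℕ → LSite d → Fin d → 𝔸) (Λ : ℕ → LSite d → 𝔸)
    (hrem : ∀ (j : ℕ) (z : LSite d) (κ : Fin d), rem j z κ = Yt (j + 1) z κ
      - (fderiv ℂ (eml : ((Fin d → Fin L) → 𝔸) → 𝔸) (fun r => ((Wcx L (avgIter L U₀ j) ((L : ℤ) • z) κ (boxVec L r) : 𝔸ˣ) : 𝔸))
            (fun r => tsum (avgIter L U₀ j) (Yt j) ((L : ℤ) • z) (gammaWord L κ (boxVec L r) ++ seg κ (-(L : ℤ)))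
              * ((Wcx L (avgIter L U₀ j) ((L : ℤ) • z) κ (boxVec L r) : 𝔸ˣ) : 𝔸))
            * (((expUnit (Xavg L (avgIter L U₀ j) ((L : ℤ) • z) κ))⁻¹ : 𝔸ˣ) : 𝔸)
          + ((expUnit (Xavg L (avgIter L U₀ j) ((L : ℤ) • z) κ) : 𝔸ˣ) : 𝔸) * tsum (avgIter L U₀ j) (Yt j) ((L : ℤ) • z) (seg κ (L : ℤ))
            * (((expUnit (Xavg L (avgIter L U₀ j) ((L : ℤ) • z) κ))⁻¹ : 𝔸ˣ) : 𝔸)))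
    (hG0 : Glin 0 = Yt 0) (hN0 : Nn 0 = 0) (hΛ0 : ∀ z, Λ 0 z = 0)
    (hGlin : ∀ (j : ℕ) (z : LSite d) (κ : Fin d), Glin (j + 1) z κ
      = (fderiv ℂ (eml : ((Fin d → Fin L) → 𝔸) → 𝔸) (fun r => ((Wcx L (avgIter L U₀ j) ((L : ℤ) • z) κ (boxVec L r) : 𝔸ˣ) : 𝔸))
            (fun r => tsum (avgIter L U₀ j) (Glin j) ((L : ℤ) • z) (gammaWord L κ (boxVec L r) ++ seg κ (-(L : ℤ)))
              * ((Wcx L (avgIter L U₀ j) ((L : ℤ) • z) κ (boxVec L r) : 𝔸ˣ) : 𝔸))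
            * (((expUnit (Xavg L (avgIter L U₀ j) ((L : ℤ) • z) κ))⁻¹ : 𝔸ˣ) : 𝔸)
          + ((expUnit (Xavg L (avgIter L U₀ j) ((L : ℤ) • z) κ) : 𝔸ˣ) : 𝔸) * tsum (avgIter L U₀ j) (Glin j) ((L : ℤ) • z) (seg κ (L : ℤ))
            * (((expUnit (Xavg L (avgIter L U₀ j) ((L : ℤ) • z) κ))⁻¹ : 𝔸ˣ) : 𝔸))
        - (FhatCov L (avgIter L U₀ j) (Glin j) ((L : ℤ) • z) - conjR (avgIter L U₀ (j + 1) z κ) (FhatCov L (avgIter L U₀ j) (Glin j) ((L : ℤ) • (z + e κ)))))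
    (hNn : ∀ (j : ℕ) (z : LSite d) (κ : Fin d), Nn (j + 1) z κ
      = (fderiv ℂ (eml : ((Fin d → Fin L) → 𝔸) → 𝔸) (fun r => ((Wcx L (avgIter L U₀ j) ((L : ℤ) • z) κ (boxVec L r) : 𝔸ˣ) : 𝔸))
            (fun r => tsum (avgIter L U₀ j) (Nn j) ((L : ℤ) • z) (gammaWord L κ (boxVec L r) ++ seg κ (-(L : ℤ)))
              * ((Wcx L (avgIter L U₀ j) ((L : ℤ) • z) κ (boxVec L r) : 𝔸ˣ) : 𝔸))
            * (((expUnit (Xavg L (avgIter L U₀ j) ((L : ℤ) • z) κ))⁻¹ : 𝔸ˣ) : 𝔸)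
          + ((expUnit (Xavg L (avgIter L U₀ j) ((L : ℤ) • z) κ) : 𝔸ˣ) : 𝔸) * tsum (avgIter L U₀ j) (Nn j) ((L : ℤ) • z) (seg κ (L : ℤ))
            * (((expUnit (Xavg L (avgIter L U₀ j) ((L : ℤ) • z) κ))⁻¹ : 𝔸ˣ) : 𝔸))
        - (FhatCov L (avgIter L U₀ j) (Nn j) ((L : ℤ) • z) - conjR (avgIter L U₀ (j + 1) z κ) (FhatCov L (avgIter L U₀ j) (Nn j) ((L : ℤ) • (z + e κ))))
        + rem j z κ)
    (hΛs : ∀ (j : ℕ) (z : LSite d), Λ (j + 1) z = FhatCov L (avgIter L U₀ j) (Glin j + Nn j) ((L : ℤ) • z) + Λ j ((L : ℤ) • z))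
    (m n g y lam : ℕ → ℝ)
    (hm : ∀ j, m j = Real.sqrt (∑ t : Fin d → Fin (N' * L ^ (k - j)), ∑ μ' : Fin d, ‖Glin j (boxVec (N' * L ^ (k - j)) t) μ'‖ ^ 2))
    (hn : ∀ j, n j = Real.sqrt (∑ t : Fin d → Fin (N' * L ^ (k - j)), ∑ μ' : Fin d, ‖Nn j (boxVec (N' * L ^ (k - j)) t) μ'‖ ^ 2))
    (hy : ∀ j, y j = Real.sqrt (∑ t : Fin d → Fin (N' * L ^ (k - j)), ∑ μ' : Fin d, ‖Yt j (boxVec (N' * L ^ (k - j)) t) μ'‖ ^ 2))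
    (hg : ∀ j, g j = Real.sqrt (∑ t : Fin d → Fin (N' * L ^ (k - j)), ∑ κ : Fin d, ∑ ν : Fin d,
      ‖conjR (avgIter L U₀ j (boxVec (N' * L ^ (k - j)) t) ν) (Glin j (boxVec (N' * L ^ (k - j)) t + e ν) κ) - Glin j (boxVec (N' * L ^ (k - j)) t) κ‖ ^ 2))
    (hlam : ∀ j, lam j = Real.sqrt (∑ t : Fin d → Fin (N' * L ^ (k - j)), ∑ κ : Fin d,
      ‖Λ j (boxVec (N' * L ^ (k - j)) t) - conjR (avgIter L U₀ j (boxVec (N' * L ^ (k - j)) t) κ) (Λ j (boxVec (N' * L ^ (k - j)) t + e κ))‖ ^ 2))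
    {ρ θ' θg θ₂ ΘM wG wN wS cA cB0 cB1 : ℝ} (hρ0 : 0 < ρ) (hρ1 : ρ < 1)
    (hρm : Real.sqrt ((L : ℝ) ^ 2 * ((L : ℝ) ^ d)⁻¹) = ρ) (hρg : Real.sqrt ((L : ℝ) ^ 4 * ((L : ℝ) ^ d)⁻¹) = ρ⁻¹)
    (hθ' : 0 ≤ θ') (hθg : 0 ≤ θg) (hθ₂ : 0 ≤ θ₂) (hΘM : 0 ≤ ΘM) (hwG : 0 ≤ wG) (hwN : 0 ≤ wN) (hwS : 0 ≤ wS) (hcA : 0 ≤ cA) (hcB0 : 0 ≤ cB0)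
    (hcB1 : 0 ≤ cB1) (wM : ℕ → ℝ) (hwM0 : ∀ j, 0 ≤ wM j) (hwMgeo : ∀ j < k, wM j ≤ ΘM * ρ ^ (4 * (k - j)))
    (hκgeo : ∀ j < k, 210 * ((2 * d + 2) * L) * α j * Real.sqrt (2 * d) ≤ θ' * ρ ^ (4 * (k - j)))
    (hKgeo : ∀ j < k, (24 * α j + 8 * (((d : ℝ) + 2) * L) ^ 2 * a j) * Real.sqrt (d * ((L : ℝ) ^ 2 * ((L : ℝ) ^ d)⁻¹))
      + 210 * ((2 * d + 2) * L) * α j * Real.sqrt (8 * (d : ℝ) ^ 2) ≤ θg * ρ ^ (4 * (k - j)))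
    (hσgeo : ∀ j < k, 260 * μ j * ((2 * d + 2) * L) * Real.sqrt (2 * d) ≤ θ₂ * ρ ^ (2 * (k - j)))
    (hrow : ∀ j ≤ k, lam j ^ 2 ≤ ∑ i ∈ Finset.range j, (ρ⁻¹) ^ (j - i) * (wG * g i ^ 2 + wN * n i ^ 2 + wM i * (m i ^ 2 + n i ^ 2)
      + wS * (260 * μ i * ((2 * d + 2) * L) * Real.sqrt (2 * d)) ^ 2 * (m i + n i + lam i) ^ 2))
    (hsmall : Real.exp (θ' * (ρ ^ 3 / (1 - ρ ^ 4))) * θ₂ * (1 + cB1) * (ρ ^ 3 / (1 - ρ ^ 4)) ≤ 1 / 2)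
    (hsmallS : 12 * wS * θ₂ ^ 2 * (ρ / (1 - ρ)) ≤ 1 / 2)
    (hcB0sq : 2 * wG * (g 0 + θg * Real.exp (θ' * (ρ ^ 3 / (1 - ρ ^ 4))) * m 0 * ρ ^ (2 * k) * (ρ ^ 3 / (1 - ρ ^ 2))) ^ 2 * (ρ / (1 - ρ)) ≤ cB0 ^ 2)
    (hcB1sq : 2 * (wN * (ρ / (1 - ρ)) + (ΘM + 3 * wS * θ₂ ^ 2) * (ρ ^ 5 / (1 - ρ ^ 5))) ≤ cB1 ^ 2)
    (hcAsq : 2 * ((ΘM + 3 * wS * θ₂ ^ 2) * (Real.exp (θ' * (ρ ^ 3 / (1 - ρ ^ 4))) * m 0) ^ 2) * (ρ / (1 - ρ)) ≤ cA ^ 2) :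
    ∀ l ≤ k, ∑ t : Fin d → Fin (N' * L ^ (k - l)), ∑ κ : Fin d, ∑ ν : Fin d,
        ‖conjR (avgIter L U₀ l (boxVec (N' * L ^ (k - l)) t) ν) (((tildIter L U₀ U₁ l (boxVec (N' * L ^ (k - l)) t + e ν) κ : 𝔸ˣ) : 𝔸) - 1)
          - (((tildIter L U₀ U₁ l (boxVec (N' * L ^ (k - l)) t) κ : 𝔸ˣ) : 𝔸) - 1)‖ ^ 2
      ≤ (4 * (g 0 + θg * Real.exp (θ' * (ρ ^ 3 / (1 - ρ ^ 4))) * m 0 * ρ ^ (2 * k) * (ρ ^ 3 / (1 - ρ ^ 2))) ^ 2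
          + 16 * d * (2 * Real.exp (θ' * (ρ ^ 3 / (1 - ρ ^ 4))) * θ₂
              * ((Real.exp (θ' * (ρ ^ 3 / (1 - ρ ^ 4))) * m 0) * (ρ ^ (2 * k + 1) / (1 - ρ ^ 2))
                + (cB0 + cA * ρ ^ (2 * k)) * (ρ ^ 3 / (1 - ρ ^ 4)))) ^ 2
          + 8 * d * (cB0 + cA * ρ ^ (2 * k) + cB1 * (2 * Real.exp (θ' * (ρ ^ 3 / (1 - ρ ^ 4))) * θ₂
              * ((Real.exp (θ' * (ρ ^ 3 / (1 - ρ ^ 4))) * m 0) * (ρ ^ (2 * k + 1) / (1 - ρ ^ 2))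
                + (cB0 + cA * ρ ^ (2 * k)) * (ρ ^ 3 / (1 - ρ ^ 4))))) ^ 2)
        * ((ρ⁻¹) ^ l) ^ 2 := by
  -- periods
  set Nc : ℕ → ℕ := fun j => N' * L ^ (k - j) with hNc
  have hL0 : 0 < L := hL
  have hNc0 : ∀ j, 0 < Nc j := fun j => by simp only [hNc]; positivity
  have hNcs : ∀ j < k, Nc j = Nc (j + 1) * L := fun j hj => by simp only [hNc]; exact period_tower_step N' L k j hj
  -- periodicity of the level objects
  have hVper : ∀ j ≤ k, IsPeriodic (Nc j) (avgIter L U₀ j) := fun j hj => avgIter_isPeriodic_level L N' k hU₀ hj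
  have hYper : ∀ j ≤ k, IsPeriodic (Nc j) (Yt j) := fun j hj => tildField_isPeriodic L N' k hU₀ hU₁ Yt hYt hj
  have hremper : ∀ j < k, IsPeriodic (Nc (j + 1)) (rem j) := fun j hj =>
    rem_isPeriodic L (Nc j) (Nc (j + 1)) (hNcs j hj) (avgIter L U₀ j) (hVper j hj.le) (Yt j) (Yt (j + 1)) (hYper j hj.le) (hYper (j + 1) hj) (rem j)
      (hrem j)
  have hY0per : IsPeriodic (Nc 0) (Yt 0) := hYper 0 (Nat.zero_le _)
  -- the three families are periodic (✓F-8b-1)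
  have hCM : ∀ (j : ℕ) (X X' : LSite d → Fin d → 𝔸) (y : LSite d),
      (fun (j : ℕ) (X : LSite d → Fin d → 𝔸) (y : LSite d) => FhatCov L (avgIter L U₀ j) X ((L : ℤ) • y)) j (X + X') y
        = (fun (j : ℕ) (X : LSite d → Fin d → 𝔸) (y : LSite d) => FhatCov L (avgIter L U₀ j) X ((L : ℤ) • y)) j X y
          + (fun (j : ℕ) (X : LSite d → Fin d → 𝔸) (y : LSite d) => FhatCov L (avgIter L U₀ j) X ((L : ℤ) • y)) j X' y :=
    fun j X X' y => cornerCharge_add L U₀ j X X' y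
  have hGt := sourced_recursion_of_split L U₀ (fun j X y => FhatCov L (avgIter L U₀ j) X ((L : ℤ) • y)) hCM rem Glin Nn hGlin hNn
  have hGtper : ∀ j ≤ k, IsPeriodic (Nc j) (Glin j + Nn j) ∧ IsPeriodic (Nc j) (Λ j) := by
    refine isPeriodic_sourced_families L Nc k hNcs (fun j => avgIter L U₀ j) hVper rem hremper (fun j => Glin j + Nn j) Λ ?_ hΛ0
      (fun j z κ => hGt j z κ) hΛs
    show IsPeriodic (Nc 0) (Glin 0 + Nn 0)
    rw [hG0, hN0, add_zero]; exact hY0per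
  obtain ⟨Λl, hΛl0, hΛls⟩ := exists_gauge_family L (fun j X y => FhatCov L (avgIter L U₀ j) X ((L : ℤ) • y)) Glin
  have hGlper : ∀ j ≤ k, IsPeriodic (Nc j) (Glin j) := fun j hj =>
    (isPeriodic_sourced_families L Nc k hNcs (fun j => avgIter L U₀ j) hVper (fun _ _ _ => 0) (fun _ _ _ _ => rfl) Glin Λl
      (by rw [hG0]; exact hY0per) hΛl0 (fun j z κ => by rw [hGlin, add_zero]) hΛls j hj).1
  have hNper : ∀ j ≤ k, IsPeriodic (Nc j) (Nn j) := fun j hj => by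
    have h1 := (hGtper j hj).1
    have h2 := hGlper j hj
    intro x m'
    have := h1 x m'
    rw [Pi.add_apply, Pi.add_apply, h2 x m'] at this
    exact add_left_cancel this
  -- the structure identity (✓F-7a) below the unit loop window
  have hW : ∀ j < k, ∀ (z : LSite d) (κ : Fin d) (r : Fin d → Fin L), ‖((Wcx L (avgIter L U₀ j) ((L : ℤ) • z) κ (boxVec L r) : 𝔸ˣ) : 𝔸) - 1‖ < 1 :=
    fun j hj z κ r => (hα j hj z κ r).trans_lt (by linarith [hα24 j hj])
  have hstruct := sourced_cornerComb_structure L U₀ k hW Yt rem (fun j z κ => by rw [hrem]; abel)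
    (fun j X y => FhatCov L (avgIter L U₀ j) X ((L : ℤ) • y)) (fun j => Glin j + Nn j) Λ (by funext z κ; rw [Pi.add_apply, hG0, hN0]; simp) hΛ0
    (fun j z κ => hGt j z κ) hΛs
  -- nonnegativity of the letters
  have hm0' : ∀ j, 0 ≤ m j := fun j => by rw [hm]; exact Real.sqrt_nonneg _
  have hn0' : ∀ j, 0 ≤ n j := fun j => by rw [hn]; exact Real.sqrt_nonneg _
  have hg0' : ∀ j, 0 ≤ g j := fun j => by rw [hg]; exact Real.sqrt_nonneg _
  have hy0' : ∀ j, 0 ≤ y j := fun j => by rw [hy]; exact Real.sqrt_nonneg _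
  have hlam0 : ∀ j, 0 ≤ lam j := fun j => by rw [hlam]; exact Real.sqrt_nonneg _
  have hn00 : n 0 = 0 := by rw [hn, hN0]; simp
  -- coordinate periodicity at the fine period `Nc (j+1) * L`
  have hcoord : ∀ {X : LSite d → Fin d → 𝔸} {j : ℕ}, j < k → IsPeriodic (Nc j) X →
      ∀ (x : LSite d) (κ μ' : Fin d), X (x + ((Nc (j + 1) * L : ℕ) : ℤ) • e κ) μ' = X x μ' := by
    intro X j hj hX x κ μ'
    rw [← hNcs j hj]; exact apply_add_period_of_isPeriodic hX x κ μ'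
  have hcoordU : ∀ {j : ℕ}, j < k → ∀ (x : LSite d) (κ μ' : Fin d),
      avgIter L U₀ j (x + ((Nc (j + 1) * L : ℕ) : ℤ) • e κ) μ' = avgIter L U₀ j x μ' := by
    intro j hj x κ μ'
    rw [← hNcs j hj]; exact apply_add_period_of_isPeriodic (hVper j hj.le) x κ μ'
  -- ★ the four rows, level by level
  have hmrec : ∀ j < k, m (j + 1) ≤ (ρ + 210 * ((2 * d + 2) * L) * α j * Real.sqrt (2 * d)) * m j := by
    intro j hj
    haveI : NeZero (Nc (j + 1)) := ⟨(hNc0 (j + 1)).ne'⟩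
    have h := sqrt_mass_lin_step_le L (Nc (j + 1)) hL U₀ j (hVu j hj.le) (Glin j) (Glin (j + 1)) (hcoord hj (hGlper j hj.le)) (hα0 j) (hα24 j hj)
      (fun z κ r => hα j hj _ κ r) (hGlin j)
    rw [hρm, sum_boxVec_congr (hNcs j hj).symm (fun x => ∑ ν : Fin d, ‖Glin j x ν‖ ^ 2)] at h
    rw [hm, hm]; exact h
  have hnrec : ∀ j < k, n (j + 1) ≤ (ρ + 210 * ((2 * d + 2) * L) * α j * Real.sqrt (2 * d)) * n j
      + 260 * μ j * ((2 * d + 2) * L) * Real.sqrt (2 * d) * y j := by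
    intro j hj
    haveI : NeZero (Nc (j + 1)) := ⟨(hNc0 (j + 1)).ne'⟩
    have h := sqrt_mass_sourced_step_le L (Nc (j + 1)) hL U₀ U₁ j (hVu j hj.le) (hTu j hj) Yt hYt (Nn j) (Nn (j + 1)) (hcoord hj (hNper j hj.le))
      (hcoord hj (hYper j hj.le)) (hα0 j) (hα24 j hj) (fun z κ r => hα j hj _ κ r) (hμ0 j) (hμ72 j hj) (hμ j hj) (rem j) (hrem j) (hNn j)
    rw [hρm, sum_boxVec_congr (hNcs j hj).symm (fun x => ∑ ν : Fin d, ‖Nn j x ν‖ ^ 2),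
      sum_boxVec_congr (hNcs j hj).symm (fun x => ∑ ν : Fin d, ‖Yt j x ν‖ ^ 2)] at h
    rw [hn, hn, hy]; exact h
  have hgrec : ∀ j < k, g (j + 1) ≤ ρ⁻¹ * g j + ((24 * α j + 8 * (((d : ℝ) + 2) * L) ^ 2 * a j) * Real.sqrt (d * ((L : ℝ) ^ 2 * ((L : ℝ) ^ d)⁻¹))
      + 210 * ((2 * d + 2) * L) * α j * Real.sqrt (8 * (d : ℝ) ^ 2)) * m j := by
    intro j hj
    haveI : NeZero (Nc (j + 1)) := ⟨(hNc0 (j + 1)).ne'⟩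
    have h := sqrt_grad_lin_step_le L (Nc (j + 1)) hL U₀ j (hVu j hj.le) (hcoordU hj) (ha0 j) (hplaq j hj) (hα0 j) (hα24 j hj) (hα j hj)
      (Glin j) (Glin (j + 1)) (hcoord hj (hGlper j hj.le)) (hGlin j)
    rw [hρg, sum_boxVec_congr (hNcs j hj).symm (fun x => ∑ κ : Fin d, ∑ ν : Fin d, ‖conjR (avgIter L U₀ j x ν) (Glin j (x + e ν) κ) - Glin j x κ‖ ^ 2),
      sum_boxVec_congr (hNcs j hj).symm (fun x => ∑ ν : Fin d, ‖Glin j x ν‖ ^ 2)] at h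
    rw [hg, hg, hm]; exact h
  have hyle : ∀ j ≤ k, y j ≤ m j + n j + lam j := by
    intro j hj
    have h := sqrt_mass_full_le (Nc j) (avgIter L U₀ j) (Yt j) (Glin j) (Nn j) (Λ j) (fun z κ => by
      have := hstruct j hj z κ; rw [Pi.add_apply] at this; exact this)
    rw [hy, hm, hn, hlam]; exact h
  -- ★ the full-field gradient row, level by level (✓F-8b-2 `sum_cell_covGrad_add_le` twice on `Ỹ = (G^{lin} + N) + ∇^{cov}Λ`)
  obtain ⟨γ, hγ⟩ : ∃ γ : ℕ → ℝ, ∀ j, γ j = Real.sqrt (∑ t : Fin d → Fin (N' * L ^ (k - j)), ∑ κ : Fin d, ∑ ν : Fin d,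
      ‖conjR (avgIter L U₀ j (boxVec (N' * L ^ (k - j)) t) ν) (Yt j (boxVec (N' * L ^ (k - j)) t + e ν) κ) - Yt j (boxVec (N' * L ^ (k - j)) t) κ‖ ^ 2) :=
    ⟨_, fun _ => rfl⟩
  have hγrow : ∀ j ≤ k, γ j ^ 2 ≤ 4 * g j ^ 2 + 16 * d * n j ^ 2 + 8 * d * lam j ^ 2 := by
    intro j hj
    haveI : NeZero (Nc j) := ⟨(hNc0 j).ne'⟩
    have hV1 : ∀ x μ', avgIter L U₀ j x μ' ∈ U1 𝔸 := fun x μ' => unitaryUnits_le_U1 (hVu j hj x μ')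
    obtain ⟨DΛ, hDΛ⟩ : ∃ D : LSite d → Fin d → 𝔸, ∀ (z : LSite d) (κ : Fin d), D z κ = Λ j z - conjR (avgIter L U₀ j z κ) (Λ j (z + e κ)) :=
      ⟨fun z κ => Λ j z - conjR (avgIter L U₀ j z κ) (Λ j (z + e κ)), fun _ _ => rfl⟩
    have hF : Yt j = (Glin j + Nn j) + DΛ := by
      funext z κ
      have := hstruct j hj z κ
      rw [← hDΛ] at this
      exact this
    have hNnP : ∀ (x : LSite d) (κ μ' : Fin d), Nn j (x + ((Nc j : ℕ) : ℤ) • e κ) μ' = Nn j x μ' :=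
      fun x κ μ' => apply_add_period_of_isPeriodic (hNper j hj) x κ μ'
    have hDΛP : ∀ (x : LSite d) (κ μ' : Fin d), DΛ (x + ((Nc j : ℕ) : ℤ) • e κ) μ' = DΛ x μ' := by
      intro x κ μ'
      rw [hDΛ, hDΛ, add_right_comm, apply_add_period_of_isPeriodic (hVper j hj) x κ μ', apply_add_period_of_isPeriodic' (hGtper j hj).2 x κ,
        apply_add_period_of_isPeriodic' (hGtper j hj).2 (x + e μ') κ]
    have h1 := sum_cell_covGrad_add_le (Nc j) (avgIter L U₀ j) hV1 (Glin j + Nn j) DΛ hDΛP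
    have h2 := sum_cell_covGrad_add_le (Nc j) (avgIter L U₀ j) hV1 (Glin j) (Nn j) hNnP
    have key : ∑ t : Fin d → Fin (Nc j), ∑ κ : Fin d, ∑ ν : Fin d,
          ‖conjR (avgIter L U₀ j (boxVec (Nc j) t) ν) (((Glin j + Nn j) + DΛ) (boxVec (Nc j) t + e ν) κ) - ((Glin j + Nn j) + DΛ) (boxVec (Nc j) t) κ‖ ^ 2
        ≤ 4 * ∑ t : Fin d → Fin (Nc j), ∑ κ : Fin d, ∑ ν : Fin d, ‖conjR (avgIter L U₀ j (boxVec (Nc j) t) ν) (Glin j (boxVec (Nc j) t + e ν) κ) - Glin j (boxVec (Nc j) t) κ‖ ^ 2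
          + 16 * d * ∑ t : Fin d → Fin (Nc j), ∑ κ : Fin d, ‖Nn j (boxVec (Nc j) t) κ‖ ^ 2
          + 8 * d * ∑ t : Fin d → Fin (Nc j), ∑ κ : Fin d, ‖DΛ (boxVec (Nc j) t) κ‖ ^ 2 := by
      have h2' := mul_le_mul_of_nonneg_left h2 (by norm_num : (0 : ℝ) ≤ 2)
      refine h1.trans ((add_le_add h2' le_rfl).trans (le_of_eq ?_))
      ring
    have hγsq : γ j ^ 2 = ∑ t : Fin d → Fin (Nc j), ∑ κ : Fin d, ∑ ν : Fin d,
        ‖conjR (avgIter L U₀ j (boxVec (Nc j) t) ν) (((Glin j + Nn j) + DΛ) (boxVec (Nc j) t + e ν) κ) - ((Glin j + Nn j) + DΛ) (boxVec (Nc j) t) κ‖ ^ 2 := by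
      rw [hγ, Real.sq_sqrt (Finset.sum_nonneg fun _ _ => Finset.sum_nonneg fun _ _ => Finset.sum_nonneg fun _ _ => sq_nonneg _), hF]
    have hgsq : g j ^ 2 = ∑ t : Fin d → Fin (Nc j), ∑ κ : Fin d, ∑ ν : Fin d,
        ‖conjR (avgIter L U₀ j (boxVec (Nc j) t) ν) (Glin j (boxVec (Nc j) t + e ν) κ) - Glin j (boxVec (Nc j) t) κ‖ ^ 2 := by
      rw [hg, Real.sq_sqrt (Finset.sum_nonneg fun _ _ => Finset.sum_nonneg fun _ _ => Finset.sum_nonneg fun _ _ => sq_nonneg _)]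
    have hnsq : n j ^ 2 = ∑ t : Fin d → Fin (Nc j), ∑ κ : Fin d, ‖Nn j (boxVec (Nc j) t) κ‖ ^ 2 := by
      rw [hn, Real.sq_sqrt (Finset.sum_nonneg fun _ _ => Finset.sum_nonneg fun _ _ => sq_nonneg _)]
    have hlsq : lam j ^ 2 = ∑ t : Fin d → Fin (Nc j), ∑ κ : Fin d, ‖DΛ (boxVec (Nc j) t) κ‖ ^ 2 := by
      have eΛ : ∀ (t : Fin d → Fin (Nc j)) (κ : Fin d),
          ‖Λ j (boxVec (Nc j) t) - conjR (avgIter L U₀ j (boxVec (Nc j) t) κ) (Λ j (boxVec (Nc j) t + e κ))‖ ^ 2 = ‖DΛ (boxVec (Nc j) t) κ‖ ^ 2 :=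
        fun t κ => by rw [hDΛ]
      rw [hlam, Real.sq_sqrt (Finset.sum_nonneg fun _ _ => Finset.sum_nonneg fun _ _ => sq_nonneg _)]
      exact Finset.sum_congr rfl fun t _ => Finset.sum_congr rfl fun κ _ => eΛ t κ
    rw [hγsq, hgsq, hnsq, hlsq]
    exact key
  -- ★ the anchored scalar closure (✓FILE S)
  have hts := grad_full_B_slot_of_rows hρ0 hρ1 hθ' hθg hθ₂ hΘM hwG hwN hwS hcA hcB0 hcB1
    (fun j => 210 * ((2 * d + 2) * L) * α j * Real.sqrt (2 * d))
    (fun j => (24 * α j + 8 * (((d : ℝ) + 2) * L) ^ 2 * a j) * Real.sqrt (d * ((L : ℝ) ^ 2 * ((L : ℝ) ^ d)⁻¹)) + 210 * ((2 * d + 2) * L) * α j * Real.sqrt (8 * (d : ℝ) ^ 2))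
    (fun j => 260 * μ j * ((2 * d + 2) * L) * Real.sqrt (2 * d)) m n g y lam wM
    (fun j => by have := hα0 j; positivity) (fun j => by have := hα0 j; have := ha0 j; positivity) (fun j => by have := hμ0 j; positivity)
    hm0' hn0' hg0' hlam0 hwM0 hκgeo hKgeo hσgeo hwMgeo hmrec hgrec hn00 hnrec hyle hrow hsmall hsmallS hcB0sq hcB1sq hcAsq
    γ (by norm_num : (0 : ℝ) ≤ 4) (by positivity : (0 : ℝ) ≤ 16 * d) (by positivity : (0 : ℝ) ≤ 8 * d) hγrow
  intro l hl
  have h := hts l hl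
  have hγl : γ l ^ 2 = ∑ t : Fin d → Fin (N' * L ^ (k - l)), ∑ κ : Fin d, ∑ ν : Fin d,
      ‖conjR (avgIter L U₀ l (boxVec (N' * L ^ (k - l)) t) ν) (((tildIter L U₀ U₁ l (boxVec (N' * L ^ (k - l)) t + e ν) κ : 𝔸ˣ) : 𝔸) - 1)
        - (((tildIter L U₀ U₁ l (boxVec (N' * L ^ (k - l)) t) κ : 𝔸ˣ) : 𝔸) - 1)‖ ^ 2 := by
    rw [hγ, Real.sq_sqrt (Finset.sum_nonneg fun _ _ => Finset.sum_nonneg fun _ _ => Finset.sum_nonneg fun _ _ => sq_nonneg _)]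
    simp_rw [hYt]
  rw [hγl] at h
  exact h

end Summit.QuantumFields.YangMills.Theorems.Prop7CornerCombCellGradMember

end
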